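import Summits.CriticalPhenomena.PercolationContinuityZ3.Theorems.PercNearOneGluingNoHeavyLowerTailSahiInterpTransform

/-!
# The interpolation leaf test for Sahi's `E_n` on `{0,1}^m`, III: sorted grid points and the grid table

Support file (cell `prim-sahi`, seat `prim-sahi-typer` gen 30; `--supports stmt-CriticalPhenomena-4575`).  Pure proofs + one auxiliary definition
(`IsRearr`, the bubble-sort invariant); standard axioms, no `sorry`.

* `isRearr_cswapA`, `isRearr_bubbleA`, `isRearr_sortA` — the array bubble sort of …`SahiInterpCheck` produces a rearrangement `x ∘ σ`,
  `σ ∈ Sym(Fin m)` (only this is used — sortedness is irrelevant for soundness); **`sortKey_eq`**: `sortKey m d x = key (x ∘ σ)`;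
* **`gridArr_getD`** — the grid table at `key x` holds `zVal m n n a (x ∘ σ)` for some `σ` (thunk entries unfold definitionally). [this work]
-/

namespace Summit.CriticalPhenomena.PercolationContinuityZ3.Theorems.SahiInterp

open Finset OneCutCert SahiC3Cube NCopyCert SahiSymCube

/-! ## Bubble sort rearranges: `sortA` produces `x ∘ σ` -/

/-- The rearrangement invariant: `ys` has size `m` and is `xs₀` read through a permutation of the positions. [this work] -/
def IsRearr (m : ℕ) (xs₀ ys : Array ℕ) : Prop :=
  ys.size = m ∧ ∃ σ : Equiv.Perm (Fin m), ∀ j : Fin m, ys.getD j 0 = xs₀.getD (σ j) 0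

/-- `IsRearr` is reflexive. [this work] -/
theorem isRearr_refl {m : ℕ} {xs : Array ℕ} (h : xs.size = m) : IsRearr m xs xs := ⟨h, 1, fun _ => rfl⟩

/-- A compare–swap keeps the rearrangement invariant. [this work] -/
theorem isRearr_cswapA {m : ℕ} {xs₀ ys : Array ℕ} (h : IsRearr m xs₀ ys) (i : ℕ) : IsRearr m xs₀ (cswapA i ys) := by
  obtain ⟨hsz, σ, hσ⟩ := h
  unfold cswapA
  by_cases hi : i + 1 < ys.size
  · rw [dif_pos hi]
    by_cases hlt : ys[i + 1] < ys[i]'(Nat.lt_of_succ_lt hi)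
    · rw [if_pos hlt]
      refine ⟨by rw [Array.size_swap]; exact hsz, Equiv.swap (⟨i, by omega⟩ : Fin m) ⟨i + 1, by omega⟩ |>.trans σ, fun j => ?_⟩
      rw [Equiv.trans_apply, ← hσ, Array.getD_eq_getD_getElem?, Array.getD_eq_getD_getElem?, Array.getElem?_swap]
      have hii : (i : ℕ) < ys.size := Nat.lt_of_succ_lt hi
      rcases j with ⟨j, hj⟩
      by_cases h1 : j = i
      · subst h1
        rw [Equiv.swap_apply_left, Fin.val_mk, Fin.val_mk, if_neg (by omega), if_pos rfl, Array.getElem?_eq_getElem hi]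
      · by_cases h2 : j = i + 1
        · subst h2
          rw [Equiv.swap_apply_right, Fin.val_mk, Fin.val_mk, if_pos rfl, Array.getElem?_eq_getElem hii]
        · rw [Equiv.swap_apply_of_ne_of_ne (fun h => h1 (Fin.mk.inj_iff.1 h)) (fun h => h2 (Fin.mk.inj_iff.1 h)), Fin.val_mk,
            if_neg (Ne.symm h2), if_neg (Ne.symm h1)]
    · rw [if_neg hlt]; exact ⟨hsz, σ, hσ⟩
  · rw [dif_neg hi]; exact ⟨hsz, σ, hσ⟩

/-- A bubble pass keeps the rearrangement invariant. [this work] -/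
theorem isRearr_bubbleA {m : ℕ} {xs₀ ys : Array ℕ} (h : IsRearr m xs₀ ys) : IsRearr m xs₀ (bubbleA m ys) := by
  unfold bubbleA
  suffices hl : ∀ (l : List ℕ) (zs : Array ℕ), IsRearr m xs₀ zs → IsRearr m xs₀ (l.foldl (fun z i => cswapA i z) zs) from hl _ _ h
  intro l
  induction l with
  | nil => intro zs hzs; exact hzs
  | cons i l ih => intro zs hzs; rw [List.foldl_cons]; exact ih _ (isRearr_cswapA hzs i)

/-- Bubble sort keeps the rearrangement invariant. [this work] -/
theorem isRearr_sortA {m : ℕ} {xs₀ : Array ℕ} : ∀ (k : ℕ) (ys : Array ℕ), IsRearr m xs₀ ys → IsRearr m xs₀ (sortA m k ys)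
  | 0, _, h => h
  | k + 1, ys, h => by rw [sortA]; exact isRearr_sortA k _ (isRearr_bubbleA h)

/-- **The key of the sorted rearrangement is the key of `x ∘ σ` for some permutation `σ`.** [this work] -/
theorem sortKey_eq {m d : ℕ} (x : Fin m → Fin (d + 1)) : ∃ σ : Equiv.Perm (Fin m), sortKey m d x = enc (x ∘ σ) := by
  obtain ⟨hsz, σ, hσ⟩ := isRearr_sortA (xs₀ := Array.ofFn fun j : Fin m => (x j : ℕ)) m _ (isRearr_refl Array.size_ofFn)
  refine ⟨σ, ?_⟩
  unfold sortKey
  show enc _ = enc _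
  congr 1
  funext j
  apply Fin.ext
  show (sortA m m (Array.ofFn fun j : Fin m => (x j : ℕ))).getD j 0 % (d + 1) = ((x (σ j) : Fin (d + 1)) : ℕ)
  rw [hσ j, getD_ofFn, dif_pos (σ j).isLt]
  exact Nat.mod_eq_of_lt (x (σ j)).isLt

/-! ## Reading the grid table -/

/-- Decoding a key. [this work] -/
theorem symm_enc {m d : ℕ} (x : Fin m → Fin (d + 1)) (h : enc x < (d + 1) ^ m) :
    finFunctionFinEquiv.symm (⟨enc x, h⟩ : Fin ((d + 1) ^ m)) = x := by
  rw [enc_fin]; exact Equiv.symm_apply_apply _ _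

/-- **Entries of the grid table**: at the key of `x` the table holds `zVal m n n a` at a rearrangement `x ∘ σ` of `x`. [this work] -/
theorem gridArr_getD (m n : ℕ) (a : Fin n → ℕ) (x : Fin m → Fin (n + 1)) :
    ∃ σ : Equiv.Perm (Fin m), (gridArr m n a).getD (enc x) 0 = zVal m n n a (fun j => ((x (σ j) : Fin (n + 1)) : ℕ)) := by
  obtain ⟨σ, hσ⟩ := sortKey_eq (d := n) x
  refine ⟨σ, ?_⟩
  simp only [gridArr]
  rw [getD_ofFn, dif_pos (enc_lt x), symm_enc x, hσ, getD_ofFn, dif_pos (enc_lt _), symm_enc]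
  rfl

end Summit.CriticalPhenomena.PercolationContinuityZ3.Theorems.SahiInterp
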